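import Literature.NumberTheory.EllipticCurves.YanZhu2026.GreenbergMainTheoremsAnyRoot
import Literature.NumberTheory.EllipticCurves.BurungaleCastellaSkinner2025.GreenbergMuInvariantGoodReduction
import HarnessLib

/-!
# Yan–Zhu 2026 (J. Algebra 693 = arXiv:2412.20078v4), Prop. 3.14 and Thm. 4.7 over the
# continuation-bound frame — GUARDED re-vendorings (period binders `Ω ≠ 0`, `δ² = ±D_K`) of the two
# `∀`-over-frames facts of `YanZhu2026/GreenbergMainTheoremsAnyRoot.lean`, with the located defect
# PROVED

Typing layer (role `literature-prover`, cell `b2b-bsdres` literature seat GEN 155; REFEREE 2 nit n196,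
escalated g191, disposition g193: "re-type the named facts with the `Ω ≠ 0` (and period-normalisation)
guard as the BCS file did, in the same ADD-A-BINDER shape"; precedent = the v2 of
`BurungaleCastellaSkinner2025/GreenbergMuInvariantGoodReduction.lean`, whose module docstring §v2 names
the two facts repaired here). Nothing in `GreenbergMainTheoremsAnyRoot.lean` is edited: its two
`∀`-facts keep their statements and names; this file adds their guarded twins, the implications
"unguarded ⟹ guarded", and kernel proofs of what the unguarded statements yield at the degenerate frame.

Source: Xiaojun Yan, Xiuwu Zhu, *Main conjectures for non-CM elliptic curves at good ordinary primes*,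
J. Algebra **693** (2026) 372–402 = arXiv:2412.20078v4 (TeX `main.tex` held at
`run/shared/lean/b2b/bsd-rank1-residual/b2b-bsdres-lit/g98/eprints/yz_v4/`; bib key
`YanZhu2024MainConjNonCM`), verbatim:

> **Theorem 3.10** (l.854–860). There exists an element `𝓛_𝔭(K) ∈ Λ_K^ur` such that for every character
> `ξ` of `Γ_K` of infinity type `(j,k)` with `0 ≤ −j ≤ k`,
> `𝓛_𝔭(K)(ξ) = (Ω_p^{k−j}/Ω_K^{k−j}) · Γ(k) · (√D_K/2π)^j · (1 − ξ⁻¹(𝔭)p⁻¹)(1 − ξ(𝔭̄)) · L(ξ,0)`,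
> where `Ω_p` and `Ω_K` are the CM periods associated with `K`. *Proof.* See [deShalit, Thm. II.4.14].
>
> **Definition 3.11** (l.865–871). `𝓛_p^Gr(f/K) := h_K · 𝓛_𝔭(K)′ · 𝓛_p^{II}(f/K)`.
>
> **Proposition 3.14** (l.896–903). `𝓛_p^Gr(f/K)⁻ · Λ_K^{ur,−} = 𝓛_p^BDP(f/K) · Λ_K^{ur,−}`.
> *Proof.* See [CGS, Proposition 2.4.5].
>
> **Theorem 4.7** (l.1022–1034). For every nontrivial multiplicative set `S ⊂ Λ_K`, the following
> statements are equivalent: (1) `S⁻¹Char_{Λ_K}(𝒳_{𝓕_ord}(E/K_∞)) ⊂ (𝓛_p^PR(E/K))`.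
> (2) `S⁻¹Char_{Λ_K}(𝒳_{𝓕_Gr}(E/K_∞))Λ_K^ur ⊂ (𝓛_p^Gr(E/K))`. The same equivalence also holds for the
> reverse inclusions.

## The located defect (same mechanism as BCS Prop. 4.2.2 v1; kernel-checked below, §Z)

The tree renders "`𝓛_𝔭(K)`" by the interpolation frame `IsKatzMeasure₂ ι 𝔭 𝔭̄ ∅ κ₁ κ₂ γ₁⁻¹ γ₂⁻¹ 1 Ω δ Ω_p LK`
(de Shalit II.4.16 (49)–(50)) and "`𝓛_p^Gr(f/K)`" by `IsGreenbergLFunctionAnyRoot₂ … LK G` (Def. 3.11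
over Thm. 3.9). Both are pure `∀`-interpolation predicates. In print `Ω_K` is a CM period — a nonzero
complex number, it sits in the DENOMINATOR of Thm. 3.10's formula (de Shalit II.4.12: `Ω ∈ ℂˣ`) — but
the frame takes `Ω : ℂ` as data, and with `Ω = 0` every prescribed Katz value vanishes (Lean's
`0⁻¹ = 0`), so the ZERO series is a Katz frame (`isKatzMeasure₂_zero_of_period_eq_zero`), over which
the zero series is a Greenberg frame (`isGreenbergLFunctionAnyRoot₂_zero_zero`) — both PROVED in
`GreenbergMuInvariantGoodReduction.lean` §Z. The two `∀`-facts of `GreenbergMainTheoremsAnyRoot.lean`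

* `prop314_span_minus_eq_span_bdp_anyRoot` (Prop. 3.14) and
* `thm47_ord_localised_iff_greenbergAnyRoot_localised` (Thm. 4.7)

quantify `∀ (Ω δ : ℂ) (Ωp) (LK G), IsKatzMeasure₂ … Ω δ Ωp LK → IsGreenbergLFunctionAnyRoot₂ … LK G → …`
with NO `Ω ≠ 0`, hence also speak about `(Ω, LK, G) = (0, 0, 0)`, where they assert things print never
says. PROVED here (§Z), from the unguarded facts and nothing else:

* `prop314_span_minus_eq_span_bdp_anyRoot.bdp_eq_zero_of_unguarded`: under the Prop. 3.14 hypotheses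
  (`GreenbergSetting`, Heegner) EVERY member `L` of Castella's BDP frame `IsBDPLFunction ι 𝔭 κ₂ γ₂ f Ω_K Ω_p′ L`
  (`Ω_K ≠ 0`) is the ZERO series — i.e. the unguarded fact says "`𝓛_p^BDP(f/K) = 0`", contradicting
  Thm. 3.13 / [CGS, 2.4.5] whenever that frame is inhabited (it is, in print; the tree cannot build a
  member, so no closed `False` is derived — the statement is nonetheless mis-stated).
* `thm47_ord_localised_iff_greenbergAnyRoot_localised.spanLeIdealAway_of_unguarded`: under the Thm. 4.7
  hypotheses (`GreenbergSetting`, (irr_K), NO Heegner hypothesis, NO (Im)) the unguarded fact yields,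
  for EVERY type-I frame `F` and EVERY `s ≠ 0`, the reverse ordinary divisibility
  `S⁻¹(𝓛_p^PR(E/K)) ⊂ S⁻¹Char_{Λ_K}(𝒳_ord(E/K_∞))` — one half of the two-variable main conjecture
  (statement 4.1 (1), "⊇"), which print proves only under Heegner + (Im) (Thm. 4.2 (1)) — for free:
  an unearned consequence exhibiting the mis-statement (clause (2)'s right side is `∃ n, sⁿ·(0) ⊆ …`,
  trivially true at `G = 0`).

## The repair (this file, §F): GUARDED twins, WEAKER than the originals

* `prop314_span_minus_eq_span_bdp_anyRoot_guarded` and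
* `thm47_ord_localised_iff_greenbergAnyRoot_localised_guarded`

are VERBATIM the original statements with the two period binders
`Ω ≠ 0 → (δ ^ 2 = D_K ∨ δ ^ 2 = −D_K) →` inserted after `∀ (Ω δ : ℂ) (Ωp …) (LK G …),` and before the
Katz frame — exactly the conjuncts every frame-SUPPLYING `∃`-fact of the tree delivers
(`thm39_def311_exists_isGreenbergLFunctionAnyRoot₂`, `thm42_XGr₂_isTorsion_charIdeal_le_greenbergAnyRoot`,
`exists_frames_of_thm42AnyRoot`, BSTW `thm617_…_PRE`, BCS `prop521_…`), so no consumer loses anything: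
where a consumer applied `h Ω δ Ωp LK G hLK hG …` it now applies `h Ω δ Ωp LK G hΩ hδ hLK hG …` with the
`hΩ hδ` it obtained together with the frame. The originals imply the twins
(`….of_unguarded`, PROVED), so nothing proved from an original is lost by switching. With `Ω ≠ 0` the
degenerate member is gone and the `∀`-statement says what print says about the genuine
`𝓛_𝔭(K)`, `𝓛_p^Gr(f/K)` (uniqueness of a bounded measure with the full interpolation property; a
rescaling of genuine period data by `c` multiplies values by `ι⁻¹(c)^{−(k−j)}`, interpolable only by a
unit, which changes no ideal). The `δ`-binder records print's `√D_K` (Thm. 3.10: `(√D_K/2π)^j`; the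
tree's `δ` with `δ² = ±D_K`, sign per de Shalit II.4.16).

NOT repaired here (recorded): the SUPERSEDED gen-3 facts `prop314_span_minus_eq_span_bdp` and
`thm47_ord_localised_iff_greenberg_localised` of `GreenbergMainTheorems.lean` carry the same omission
but are already marked "do not cite" (vacuous value frame `IsGreenbergLFunction₂`, that file's STATUS
(D1)); a guarded twin of a do-not-cite fact would be a named fact without a consumer (D-0026), so none is
filed — their successors' twins below are the objects of record. `cor54_…AnyRoot_plus` carries
`plus G ≠ 0 →`, which already excludes the degenerate member. The BCS facts `cor414_…` / `thm413_…`
are repaired in the sibling `BurungaleCastellaSkinner2025/OrdinaryGreenbergEquivalenceGuarded.lean`.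
The Summits-side consumers (`Rank1Residual/TwoVariableGreenbergMainConjecture{,AnyRoot,AnyRootEdges}.lean`,
`TwoVariableMainConjectureSemistableBSTWEdges.lean`) are the provers' pen and are not touched.

D-0026: two NEW named facts, each the guarded re-vendoring of a mis-stated one (REFEREE 2 n196 protocol,
E608 precedent); four theorems PROVED; no statement of the tree edited. Honest framing: refereed
statements typed as named facts with their printed hypotheses; typed ≠ proved ≠ endorsed; nothing here
bears on BSD beyond supplying by-name inputs; the cell flag `YZ26@3-BF-ERL-Ohta` on Thm. 4.7 at `p = 3`
is unaffected.

## References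
* [YanZhu2024MainConjNonCM] J. Algebra 693 (2026) = arXiv:2412.20078v4: Thm. 3.10 (TeX l.854–863, the
  CM periods `Ω_p, Ω_K`), Def. 3.11 (l.865–871), Prop. 3.14 (l.896–903), §4.1 setting (l.909–915),
  Thm. 4.2 (l.932–949), Thm. 4.7 (l.1022–1034).
* [deShalit1987] E. de Shalit, *Iwasawa theory of elliptic curves with complex multiplication*,
  II.4.12 (the period pair, `Ω ∈ ℂˣ`), II.4.14, II.4.16 (49)–(50) (the frame `IsKatzMeasure₂`).
* [CastellaGrossiSkinner2025] Math. Ann. 393 (2025): Prop. 2.4.5 (the comparison behind Prop. 3.14),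
  Prop. 4.2.1.
* [Castella2018] Camb. J. Math. 6 (2018), Thm. 3.1 (the BDP frame `IsBDPLFunction`, `Ω_K ≠ 0`).
* [BurungaleCastellaSkinner2025] IMRN 2025 = arXiv:2405.00270v2, Prop. 4.1.3 / Prop. 4.2.2 (the
  precedent repair, `GreenbergMuInvariantGoodReduction.lean` §v2).
* [BurungaleSkinnerTianWan2024] arXiv:2409.01350, Prop. 9.18 (the printed proof of Thm. 4.7).
-/

noncomputable section

open scoped Classical

open PowerSeries NumberField IsDedekindDomain Field CongruenceSubgroup Polynomial
  Literature.NumberTheory.GaloisRepresentations Literature.NumberTheory.EllipticCurves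
  Literature.NumberTheory.EllipticCurves.ModularForms Literature.NumberTheory.EllipticCurves.Rank1Residual

namespace Literature.NumberTheory.EllipticCurves.YanZhu2026

open IwasawaAlgebra₂ UnrSeries₂

/-! ## §Z. PROVED: what the UNGUARDED facts assert at the degenerate frame `(Ω, LK, G) = (0, 0, 0)` -/

section Located

variable {p : ℕ} [Fact p.Prime]

/-- **Located defect, Prop. 3.14 as typed without `Ω ≠ 0` (kernel-checked).** From the unguarded fact
`prop314_span_minus_eq_span_bdp_anyRoot` ALONE: under its hypotheses (`GreenbergSetting`, Heegner),
every member `L` of the BDP frame at `γ₂` with `Ω_K ≠ 0` is the ZERO series. Mechanism: instantiate the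
fact's Katz/Greenberg binders at the degenerate frame `(Ω, δ, Ω_p, LK, G) = (0, 0, 1, 0, 0)`
(`isKatzMeasure₂_zero_of_period_eq_zero`, `isGreenbergLFunctionAnyRoot₂_zero_zero`); its conclusion
reads `(G⁻) = (0) = (J₀ L)` in `𝒪_{ℂ_p}⟦T⟧` along a structure-compatible `J₀ : R₀ → 𝒪_{ℂ_p}` (one
exists, `exists_ringHom_unrIntegers_padicComplexInt`; it is injective on coefficients), so `L = 0`.
Print says the opposite (`𝓛_p^BDP(f/K) ≠ 0`: Thm. 3.13 and μ = 0, [CGS, 2.4.5]); the tree cannot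
construct a BDP frame member, so no closed `False` follows — the fact is nonetheless MIS-STATED, and the
guarded twin `prop314_span_minus_eq_span_bdp_anyRoot_guarded` (§F) is the statement to cite.
[cite: YanZhu2024MainConjNonCM, Prop. 3.14 (arXiv:2412.20078v4 TeX l.896–903) with Thm. 3.10 (l.854–863: Ω_K a CM period) and Thm. 3.13 (l.882–893)]
[cite: deShalit1987, II.4.12, II.4.16 (49)–(50) (Ω ∈ ℂˣ)] -/
theorem prop314_span_minus_eq_span_bdp_anyRoot.bdp_eq_zero_of_unguarded
    (h : prop314_span_minus_eq_span_bdp_anyRoot) (ι : PadicAlgCl p ≃+* ℂ) (W : WeierstrassCurve ℚ)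
    [W.IsGloballyMinimal] (K : Type) [Field K] [NumberField K] (v vbar : HeightOneSpectrum (𝓞 K))
    (κ₁ κ₂ : ZpExtension K p) (γ₁ γ₂ : absoluteGaloisGroup K)
    [Fact (ZpExtension.IsTopGeneratorPair κ₁ κ₂ γ₁ γ₂)] {N : ℕ} [NeZero N] {f : CuspForm (Gamma0 N) 2}
    (hf : IsNewformOf W f) [NeZero (NumberField.discr K).natAbs]
    (hS : GreenbergSetting ι W N K v vbar κ₁ κ₂) (hH : SatisfiesHeegnerHypothesis N K)
    (ΩK : ℂ) (Ωp' : (unrIntegers p)ˣ) (L : UnrSeries p) (hΩK : ΩK ≠ 0)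
    (hL : IsBDPLFunction ι v κ₂ γ₂ f ΩK ((Ωp' : unrIntegers p) : ℂ_[p]) L) : L = 0 := by
  obtain ⟨J₀, hJ₀⟩ := exists_ringHom_unrIntegers_padicComplexInt (p := p)
  have hspan := h ι W K v vbar κ₁ κ₂ γ₁ γ₂ hf hS hH 0 0 1 0 0
    (isKatzMeasure₂_zero_of_period_eq_zero ι v vbar ∅ κ₁ κ₂ γ₁⁻¹ γ₂⁻¹ 1 0 _)
    (isGreenbergLFunctionAnyRoot₂_zero_zero ι v vbar κ₁ κ₂ γ₁⁻¹ γ₂⁻¹ f _ _) ΩK Ωp' L hΩK hL J₀ hJ₀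
  have hminus : minus (0 : PowerSeries (PowerSeries (PadicComplexInt p))) = 0 := by
    ext j; simp
  rw [hminus, Ideal.span_singleton_eq_bot.mpr rfl, eq_comm, Ideal.span_singleton_eq_bot] at hspan
  ext n
  have hn : J₀ (PowerSeries.coeff n L) = 0 := by
    simpa [PowerSeries.coeff_map] using congrArg (PowerSeries.coeff n) hspan
  have hval : ((PowerSeries.coeff n L : unrIntegers p) : ℂ_[p]) = 0 := by
    rw [← hJ₀, hn]; rfl
  exact_mod_cast hval

/-- **Located defect, Thm. 4.7 as typed without `Ω ≠ 0` (kernel-checked).** From the unguarded fact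
`thm47_ord_localised_iff_greenbergAnyRoot_localised` ALONE: under its hypotheses (`GreenbergSetting`,
(irr_K), `ι₁` compatible with `ι` — NO Heegner hypothesis, NO (Im)), for EVERY type-I frame
`F = 𝓛_p^I(f_E/K)` and EVERY `s ≠ 0`, the reverse ordinary divisibility
`S⁻¹(𝓛_p^PR(E/K)) ⊂ S⁻¹Char_{Λ_K}(𝒳_ord(E/K_∞))` (`SpanLeIdealAway s`). Mechanism: at the degenerate
frame `(Ω, LK, G) = (0, 0, 0)` the Greenberg side of the fact's second equivalence is
`∃ n, (J s)ⁿ·(0) ⊆ Char(X_Gr)·𝒪_{ℂ_p}⟦T₁,T₂⟧`, which holds with `n = 0`; a structure-compatible `J`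
exists (`exists_structureMap_padicInt`). Print proves this divisibility only under Heegner + (Im)
(Thm. 4.2 (1)); obtaining it from Thm. 4.7's hypotheses alone exhibits the MIS-STATEMENT. Cite the
guarded twin `thm47_ord_localised_iff_greenbergAnyRoot_localised_guarded` (§F) instead.
[cite: YanZhu2024MainConjNonCM, Thm. 4.7 (arXiv:2412.20078v4 TeX l.1022–1034) with Thm. 4.2 (1) (l.932–940) and Thm. 3.10 (l.854–863: Ω_K a CM period)]
[cite: deShalit1987, II.4.12, II.4.16 (49)–(50) (Ω ∈ ℂˣ)] -/
theorem thm47_ord_localised_iff_greenbergAnyRoot_localised.spanLeIdealAway_of_unguarded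
    (h : thm47_ord_localised_iff_greenbergAnyRoot_localised)
    (ι₁ : integralClosure ℚ ℂ →+* ℂ_[p]) (ι : PadicAlgCl p ≃+* ℂ) (W : WeierstrassCurve ℚ) [W.IsElliptic]
    [W.IsGloballyMinimal] (K : Type) [Field K] [NumberField K] (v vbar : HeightOneSpectrum (𝓞 K))
    (κ₁ κ₂ : ZpExtension K p) (γ₁ γ₂ : absoluteGaloisGroup K)
    [Fact (ZpExtension.IsTopGeneratorPair κ₁ κ₂ γ₁ γ₂)] {N : ℕ} [NeZero N]
    (π : ModularParametrizationData W N) [NeZero (NumberField.discr K).natAbs]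
    (hS : GreenbergSetting ι W N K v vbar κ₁ κ₂) (hirr : (W.baseChange K).HasIrreducibleModPGaloisRep p)
    (hι : ∀ z : integralClosure ℚ ℂ, ι₁ z = ((ι.symm (z : ℂ) : PadicAlgCl p) : ℂ_[p]))
    (F : CycAntiSeries p) (hF : IsHidaRankinLFunction ι₁ W κ₁ κ₂ π.f F) (hc : IsCongruenceIntegral π.f F)
    (s : IwasawaAlgebra₂ p) (hs : s ≠ 0) :
    SpanLeIdealAway s (perrinRiouLFunction W π F)
      (WeierstrassCurve.XOrd₂.charIdeal (W.baseChange K) p κ₁ κ₂ γ₁ γ₂) := by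
  obtain ⟨J, hJ⟩ := exists_structureMap_padicInt (p := p)
  have h2 := (h ι₁ ι W K v vbar κ₁ κ₂ γ₁ γ₂ π hS hirr hι F hF hc 0 0 1 0 0
    (isKatzMeasure₂_zero_of_period_eq_zero ι v vbar ∅ κ₁ κ₂ γ₁⁻¹ γ₂⁻¹ 1 0 _)
    (isGreenbergLFunctionAnyRoot₂_zero_zero ι v vbar κ₁ κ₂ γ₁⁻¹ γ₂⁻¹ π.f _ _) J hJ s hs).2
  refine h2.mpr ⟨0, ?_⟩
  rw [Ideal.span_singleton_eq_bot.mpr rfl, Ideal.mul_bot]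
  exact bot_le

end Located

/-! ## §F. The GUARDED named facts (Prop. 3.14, Thm. 4.7 — period binders `Ω ≠ 0`, `δ² = ±D_K`) -/

section Facts

/-- **Yan–Zhu, J. Algebra 693 (2026), Proposition 3.14 (arXiv v4 l.896–903; = [CGS25, Prop. 2.4.5]):
`𝓛_p^Gr(f/K)⁻ · Λ_K^{ur,−} = 𝓛_p^BDP(f/K) · Λ_K^{ur,−}` — GUARDED re-vendoring** of
`prop314_span_minus_eq_span_bdp_anyRoot` (`GreenbergMainTheoremsAnyRoot.lean`; mis-stated as a
`∀`-statement over frames WITHOUT the period binder, module docstring and §Z). VERBATIM that statement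
with `Ω ≠ 0 → (δ² = D_K ∨ δ² = −D_K) →` inserted before the Katz frame: under §3.5's standing
assumptions carried by `GreenbergSetting` ("`D_K` is odd, `D_K ≠ −3`", l.882; good ordinary `p > 2`,
(spl), `(N, D_K) = 1`) and the Heegner hypothesis, for `f = f_E` (`W/ℚ` globally minimal, `N = N_E`),
`(κ₁, κ₂)` with an adapted generator pair `(γ₁, γ₂)`: for EVERY Katz frame with GENUINE period data —
`Ω ≠ 0` (print's CM period `Ω_K`, in the denominator of Thm. 3.10), `δ² = ±D_K` (print's `√D_K`),
`Ω_p ∈ R₀ˣ`, `IsKatzMeasure₂ ι 𝔭 𝔭̄ ∅ κ₁ κ₂ γ₁⁻¹ γ₂⁻¹ 1 Ω δ Ω_p LK` — EVERY `G` with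
`IsGreenbergLFunctionAnyRoot₂ ι 𝔭 𝔭̄ κ₁ κ₂ γ₁⁻¹ γ₂⁻¹ f |D_K| h_K LK G` (print's `𝓛_p^Gr(f/K)`), EVERY BDP
frame `(Ω_K ≠ 0, Ω_p′, L)` at the PLAIN generator `γ₂` (`IsBDPLFunction ι 𝔭 κ₂ γ₂ f Ω_K Ω_p′ L`, Castella's
`L_p(f)` = print's `𝓛_p^BDP(f/K)`, (D2) of the AnyRoot file), and every structure-compatible
`J₀ : R₀ → 𝒪_{ℂ_p}`, the one-variable series `G⁻ = minus G` and `J₀ L` generate the SAME ideal of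
`𝒪_{ℂ_p}⟦T⟧`. WEAKER than the unguarded statement (two extra hypotheses; `….of_unguarded`); says what
print says about the genuine objects. Users take `(h : prop314_span_minus_eq_span_bdp_anyRoot_guarded)`
and feed `hΩ hδ` from their frame supplier (`thm39_def311_…AnyRoot₂` / `exists_frames_of_thm42AnyRoot`).
[cite: YanZhu2024MainConjNonCM, Prop. 3.14 (§3.5, arXiv:2412.20078v4 TeX l.896–903) with Thm. 3.10 (l.854–863: "Ω_p and Ω_K are the CM periods associated with K"), Def. 3.11 (l.865–871), Thm. 3.13 (l.882–893), §3.5 setting l.882, conventions l.462–463]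
[cite: CastellaGrossiSkinner2025, Prop. 2.4.5 (final TeX l.1021–1054)]
[cite: Castella2018, Thm. 3.1 (the normalisation `IsBDPLFunction`)]
[cite: deShalit1987, II.4.12, II.4.16 (49)–(50) (the period pair (Ω, Ω_p), Ω ∈ ℂˣ, δ = √(±d_K))] -/
def prop314_span_minus_eq_span_bdp_anyRoot_guarded : Prop :=
  ∀ {p : ℕ} [Fact p.Prime] (ι : PadicAlgCl p ≃+* ℂ) (W : WeierstrassCurve ℚ) [W.IsGloballyMinimal]
    (K : Type) [Field K] [NumberField K] (v vbar : HeightOneSpectrum (𝓞 K)) (κ₁ κ₂ : ZpExtension K p)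
    (γ₁ γ₂ : absoluteGaloisGroup K) [Fact (ZpExtension.IsTopGeneratorPair κ₁ κ₂ γ₁ γ₂)]
    {N : ℕ} [NeZero N] {f : CuspForm (Gamma0 N) 2} (_ : IsNewformOf W f)
    [NeZero (NumberField.discr K).natAbs],
    GreenbergSetting ι W N K v vbar κ₁ κ₂ → SatisfiesHeegnerHypothesis N K →
    -- every Katz frame with GENUINE period data, and every Greenberg frame over it
    ∀ (Ω δ : ℂ) (Ωp : (unrIntegers p)ˣ) (LK G : PowerSeries (PowerSeries (PadicComplexInt p))),
      Ω ≠ 0 → (δ ^ 2 = (NumberField.discr K : ℂ) ∨ δ ^ 2 = -(NumberField.discr K : ℂ)) →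
      IsKatzMeasure₂ ι v vbar ∅ κ₁ κ₂ γ₁⁻¹ γ₂⁻¹ 1 Ω δ ((Ωp : unrIntegers p) : ℂ_[p]) LK →
      IsGreenbergLFunctionAnyRoot₂ ι v vbar κ₁ κ₂ γ₁⁻¹ γ₂⁻¹ f (NumberField.discr K).natAbs
        (NumberField.classNumber K) LK G →
    -- every BDP frame at the plain anticyclotomic generator
    ∀ (ΩK : ℂ) (Ωp' : (unrIntegers p)ˣ) (L : UnrSeries p), ΩK ≠ 0 →
      IsBDPLFunction ι v κ₂ γ₂ f ΩK ((Ωp' : unrIntegers p) : ℂ_[p]) L →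
    ∀ (J₀ : unrIntegers p →+* PadicComplexInt p),
      (∀ x : unrIntegers p, ((J₀ x : PadicComplexInt p) : ℂ_[p]) = (x : ℂ_[p])) →
      Ideal.span {minus G} = Ideal.span {PowerSeries.map J₀ L}

/-- **Yan–Zhu, J. Algebra 693 (2026), Theorem 4.7 (arXiv v4 l.1022–1034) — the Beilinson–Flach
EQUIVALENCE of the two `S`-localised two-variable divisibilities — GUARDED re-vendoring** of
`thm47_ord_localised_iff_greenbergAnyRoot_localised` (`GreenbergMainTheoremsAnyRoot.lean`; mis-stated as a
`∀`-statement over frames WITHOUT the period binder, module docstring and §Z). Verbatim: "For every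
nontrivial multiplicative set `S ⊂ Λ_K`, the following statements are equivalent: (1)
`S⁻¹Char_{Λ_K}(𝒳_{𝓕_ord}(E/K_∞)) ⊂ (𝓛_p^PR(E/K))`. (2) `S⁻¹Char_{Λ_K}(𝒳_{𝓕_Gr}(E/K_∞))Λ_K^ur ⊂
(𝓛_p^Gr(E/K))`. The same equivalence also holds for the reverse inclusions." Setting §4.1 (l.909–915:
`E/ℚ` of conductor `N`, `p > 2` good ordinary, `K` imaginary quadratic with `p` split, `ρ̄_E|_{G_K}`
irreducible; `(N, D_K) = 1` from §2.1) — NO Heegner hypothesis, NO (Im). VERBATIM the AnyRoot statement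
with `Ω ≠ 0 → (δ² = D_K ∨ δ² = −D_K) →` inserted before the Katz frame: under `GreenbergSetting` and
`HasIrreducibleModPGaloisRep` of the base change, `ι₁` compatible with `ι`, for EVERY ordinary-side frame
`F = 𝓛_p^I(f_E/K)` (`IsHidaRankinLFunction ι₁ W κ₁ κ₂ π.f F ∧ IsCongruenceIntegral π.f F`,
`𝓛_p^PR = perrinRiouLFunction W π F`), EVERY Katz frame with GENUINE period data (`Ω ≠ 0`, `δ² = ±D_K`,
`Ω_p ∈ R₀ˣ`) and EVERY Greenberg frame `G` over it at the inverse generators, every structure-compatible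
`J`, and every `s ≠ 0` in `Λ_K` (`S = {sⁿ}`, (T8)):
`[S⁻¹Char(X_ord) ⊂ (𝓛_p^PR)] ↔ [∃ n, sⁿ·Char(X_Gr)𝒪_{ℂ_p}⟦T₁,T₂⟧ ⊆ (G)]` AND
`[S⁻¹(𝓛_p^PR) ⊂ S⁻¹Char(X_ord)] ↔ [∃ n, sⁿ·(G) ⊆ Char(X_Gr)𝒪_{ℂ_p}⟦T₁,T₂⟧]`, where
`X_ord = (W.baseChange K).XOrd₂ p κ₁ κ₂ γ₁ γ₂`, `X_Gr = (W.baseChange K).XGr₂ p κ₁ κ₂ 𝔭̄ γ₁ γ₂`. WEAKER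
than the unguarded statement (`….of_unguarded`); says what print says about the genuine `𝓛_p^Gr(E/K)`.
The cell flag `YZ26@3-BF-ERL-Ohta` (the printed proof = [BSTW, Prop. 9.18] at `p = 3`) bears on this
statement exactly as on the original. Users take `(h : thm47_ord_localised_iff_greenbergAnyRoot_localised_guarded)`.
[cite: YanZhu2024MainConjNonCM, Thm. 4.7 (§4.3, arXiv:2412.20078v4 TeX l.1022–1034) with setting l.909–915, §2.1 l.468, Thm. 3.10 (l.854–863: the CM periods), conventions l.462–463]
[cite: BurungaleSkinnerTianWan2024, Prop. 9.18] [cite: BurungaleCastellaSkinner2025, Prop. 4.1.3] [cite: CastellaGrossiSkinner2025, Prop. 4.2.1]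
[cite: deShalit1987, II.4.12, II.4.16 (49)–(50) (Ω ∈ ℂˣ, δ = √(±d_K))] -/
def thm47_ord_localised_iff_greenbergAnyRoot_localised_guarded : Prop :=
  ∀ {p : ℕ} [Fact p.Prime] (ι₁ : integralClosure ℚ ℂ →+* ℂ_[p]) (ι : PadicAlgCl p ≃+* ℂ)
    (W : WeierstrassCurve ℚ) [W.IsElliptic] [W.IsGloballyMinimal] (K : Type) [Field K] [NumberField K]
    (v vbar : HeightOneSpectrum (𝓞 K)) (κ₁ κ₂ : ZpExtension K p) (γ₁ γ₂ : absoluteGaloisGroup K)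
    [Fact (ZpExtension.IsTopGeneratorPair κ₁ κ₂ γ₁ γ₂)] {N : ℕ} [NeZero N]
    (π : ModularParametrizationData W N) [NeZero (NumberField.discr K).natAbs],
    GreenbergSetting ι W N K v vbar κ₁ κ₂ → (W.baseChange K).HasIrreducibleModPGaloisRep p →
    (∀ z : integralClosure ℚ ℂ, ι₁ z = ((ι.symm (z : ℂ) : PadicAlgCl p) : ℂ_[p])) →
    ∀ F : CycAntiSeries p, IsHidaRankinLFunction ι₁ W κ₁ κ₂ π.f F → IsCongruenceIntegral π.f F →
    -- every Katz frame with GENUINE period data, and every Greenberg frame over it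
    ∀ (Ω δ : ℂ) (Ωp : (unrIntegers p)ˣ) (LK G : PowerSeries (PowerSeries (PadicComplexInt p))),
      Ω ≠ 0 → (δ ^ 2 = (NumberField.discr K : ℂ) ∨ δ ^ 2 = -(NumberField.discr K : ℂ)) →
      IsKatzMeasure₂ ι v vbar ∅ κ₁ κ₂ γ₁⁻¹ γ₂⁻¹ 1 Ω δ ((Ωp : unrIntegers p) : ℂ_[p]) LK →
      IsGreenbergLFunctionAnyRoot₂ ι v vbar κ₁ κ₂ γ₁⁻¹ γ₂⁻¹ π.f (NumberField.discr K).natAbs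
        (NumberField.classNumber K) LK G →
    ∀ J : ℤ_[p] →+* PadicComplexInt p,
      (∀ x : ℤ_[p], ((J x : PadicComplexInt p) : ℂ_[p]) = ((x : ℚ_[p]) : ℂ_[p])) →
    ∀ s : IwasawaAlgebra₂ p, s ≠ 0 →
      (IdealLeSpanAway s (WeierstrassCurve.XOrd₂.charIdeal (W.baseChange K) p κ₁ κ₂ γ₁ γ₂)
          (perrinRiouLFunction W π F) ↔
        ∃ n : ℕ, Ideal.span {toUnr₂ p J s ^ n} *
            (WeierstrassCurve.XGr₂.charIdeal (W.baseChange K) p κ₁ κ₂ vbar γ₁ γ₂).map (toUnr₂ p J) ≤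
          Ideal.span {G}) ∧
      (SpanLeIdealAway s (perrinRiouLFunction W π F)
          (WeierstrassCurve.XOrd₂.charIdeal (W.baseChange K) p κ₁ κ₂ γ₁ γ₂) ↔
        ∃ n : ℕ, Ideal.span {toUnr₂ p J s ^ n} * Ideal.span {G} ≤
          (WeierstrassCurve.XGr₂.charIdeal (W.baseChange K) p κ₁ κ₂ vbar γ₁ γ₂).map (toUnr₂ p J))

end Facts

/-! ## §C. PROVED: the unguarded facts imply the guarded twins (switching loses nothing) -/

section API

/-- `prop314_…_anyRoot → prop314_…_anyRoot_guarded`: the guarded twin is WEAKER (two extra hypotheses,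
dropped). Recorded so that nothing proved from the original is lost by switching; the converse fails
(§Z). [cite: YanZhu2024MainConjNonCM, Prop. 3.14 (arXiv:2412.20078v4 TeX l.896–903)] -/
theorem prop314_span_minus_eq_span_bdp_anyRoot_guarded.of_unguarded
    (h : prop314_span_minus_eq_span_bdp_anyRoot) : prop314_span_minus_eq_span_bdp_anyRoot_guarded :=
  fun ι W _ K _ _ v vbar κ₁ κ₂ γ₁ γ₂ _ _ _ _ hf _ hS hH Ω δ Ωp LK G _ _ hLK hG ΩK Ωp' L hΩK hL J₀ hJ₀ ↦
    h ι W K v vbar κ₁ κ₂ γ₁ γ₂ hf hS hH Ω δ Ωp LK G hLK hG ΩK Ωp' L hΩK hL J₀ hJ₀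

/-- `thm47_…AnyRoot_… → thm47_…AnyRoot_…_guarded`: the guarded twin is WEAKER (two extra hypotheses,
dropped). Recorded so that nothing proved from the original is lost by switching; the converse fails
(§Z). [cite: YanZhu2024MainConjNonCM, Thm. 4.7 (arXiv:2412.20078v4 TeX l.1022–1034)] -/
theorem thm47_ord_localised_iff_greenbergAnyRoot_localised_guarded.of_unguarded
    (h : thm47_ord_localised_iff_greenbergAnyRoot_localised) :
    thm47_ord_localised_iff_greenbergAnyRoot_localised_guarded :=
  fun ι₁ ι W _ _ K _ _ v vbar κ₁ κ₂ γ₁ γ₂ _ _ _ π _ hS hirr hι F hF hc Ω δ Ωp LK G _ _ hLK hG J hJ s hs ↦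
    h ι₁ ι W K v vbar κ₁ κ₂ γ₁ γ₂ π hS hirr hι F hF hc Ω δ Ωp LK G hLK hG J hJ s hs

end API

end Literature.NumberTheory.EllipticCurves.YanZhu2026

end
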